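import Summits.PneNP.PneNP.Theorems.KarlinRubinMonotoneBlindDnfBlind

/-!
# Route KarlinRubin, crux `MonotoneBlind` (stmt-PneNP-18027): quiet monotone CNFs are blind (depth 2, AND side)

The easy half of depth 2 (the OR side — DNFs — is `KarlinRubinMonotoneBlindDnfBlind.lean`). A monotone CNF on the edge
slots of `Kₙ` is given by its clause family `𝓒` (finite sets of slots); it accepts `x` iff every clause meets `x`.
**Theorem** (`karlinRubin_cnf_planted_tendsto_zero`): for `0 < δ < 1/2` and `c : ℕ`, if `#(𝓒 n) ≤ n^c` eventually and
the null acceptance `→ 0`, then the planted acceptance (`k = ⌈n^{1/2-δ}⌉`) `→ 0`; hence no such family has error sum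
`→ 0` (`karlinRubin_monotoneBlind_cnf`). Proof (locality, no witness lemma needed): if the planted graph satisfies the CNF
but `x` does not, some clause dead in `x` is revived by a slot inside `A`; a dead LARGE clause (`≥ L` slots) has null
probability `≤ 2^{-L}` (union over `≤ n^c` clauses), and a CHOSEN small dead clause (`< L` slots, `≤ 2L` vertices) is
touched by the independent planted set with probability `≤ C(2L,2) d²/n²` (`cnf_planted_le`). With `L = (c+3)(⌊log₂ n⌋+1)`
both are `O(n^{-2})·polylog` (`karlinRubin_cnf_planted_tendsto_zero`).

All `--supports stmt-PneNP-18027`; no definitions.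
-/

set_option linter.dupNamespace false -- `Summit.PneNP.PneNP.…`: summit = sub-problem (D-0017)

namespace Summit.PneNP.PneNP.Theorems

open Filter Topology Finset
open scoped ENNReal
open Literature.Computability.Complexity
open Literature.Probability.RandomGraphs.PlantedClique

variable {n : ℕ}

/-! ### A fixed set of slots is all OFF with probability `≤ 2^{-|D|}` -/

/-- Injection count: the bit vectors that are `false` on `D`, times `2^{|D|}`, number at most all bit vectors
(complementing every bit maps them onto the vectors `true` on `D`). [folklore] -/
theorem card_filter_forall_eq_false_mul_le {E : Type*} [Fintype E] [DecidableEq E] (D : Finset E) :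
    (univ.filter fun x : E → Bool => ∀ e ∈ D, x e = false).card * 2 ^ D.card ≤ 2 ^ Fintype.card E := by
  classical
  have hbij : (univ.filter fun x : E → Bool => ∀ e ∈ D, x e = false).card =
      (univ.filter fun x : E → Bool => ∀ e ∈ D, x e = true).card := by
    refine card_bij (fun x _ => fun e => !x e) (fun x hx => ?_) (fun x _ y _ hxy => ?_) (fun y hy => ?_)
    · rw [mem_filter] at hx ⊢
      exact ⟨mem_univ _, fun e he => by simp [hx.2 e he]⟩
    · funext e
      have := congr_fun hxy e
      simpa using this
    · rw [mem_filter] at hy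
      refine ⟨fun e => !y e, mem_filter.2 ⟨mem_univ _, fun e he => by simp [hy.2 e he]⟩, ?_⟩
      funext e; simp
  rw [hbij]
  exact card_filter_forall_eq_true_mul_le D

/-- Under `G(n,1/2)` a fixed clause is dead (all slots off) with probability `≤ 2^{-|S|}`. [folklore] -/
theorem erdosRenyiHalf_forall_eq_false_le (S : Finset (⊤ : SimpleGraph (Fin n)).edgeSet) :
    (erdosRenyiHalf n).toOuterMeasure {x | ∀ e ∈ S, x e = false} ≤ 2⁻¹ ^ #S := by
  classical
  refine erdosRenyiHalf_le_half_pow_of_card_mul_le _ _ ?_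
  have h := card_filter_forall_eq_false_mul_le S
  have hset : (univ.filter fun x : EdgeVec n => x ∈ {x : EdgeVec n | ∀ e ∈ S, x e = false}) =
      univ.filter fun x : EdgeVec n => ∀ e ∈ S, x e = false := by
    ext x; simp
  rw [hset]
  exact h

/-! ### The per-`n` inequality -/

/-- **Planted acceptance of a monotone CNF (per `n`).** For every clause family `𝓒` and threshold `L`:
`Pr_planted[CNF] ≤ Pr_null[CNF] + #𝓒 · 2^{-L} + C(2L, 2) d²/n²` (`d = min k n`, `0 < n`): if the planted graph
satisfies the CNF and `x` does not, a clause dead in `x` is revived by a slot inside `A`; dead large clauses are rare under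
the null, and a chosen small dead clause (`≤ 2L` vertices) is touched by the independent planted set with probability
`≤ C(2L,2) d²/n²`. [folklore] -/
theorem cnf_planted_le (hn : 0 < n) (k L : ℕ) (𝓒 : Finset (Finset (⊤ : SimpleGraph (Fin n)).edgeSet)) :
    (plantedCliqueDist n k).toOuterMeasure {x | ∀ S ∈ 𝓒, ∃ e ∈ S, x e = true} ≤
      (erdosRenyiHalf n).toOuterMeasure {x | ∀ S ∈ 𝓒, ∃ e ∈ S, x e = true} +
        (#𝓒 : ℝ≥0∞) * 2⁻¹ ^ L +
        (((2 * L).choose 2 * (min k n) ^ 2 : ℕ) : ℝ≥0∞) / ((n ^ 2 : ℕ) : ℝ≥0∞) := by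
  classical
  set KS := kSubsets n k with hKS
  set P0 := erdosRenyiHalf n with hP0
  set μ := P0.toOuterMeasure {x | ∀ S ∈ 𝓒, ∃ e ∈ S, x e = true} with hμ
  -- a chosen small dead clause of `x` (junk `∅` if none)
  let dead : EdgeVec n → Finset (⊤ : SimpleGraph (Fin n)).edgeSet → Prop := fun x S => ∀ e ∈ S, x e = false
  let hasSmall : EdgeVec n → Prop := fun x => ∃ S ∈ 𝓒, #S < L ∧ dead x S
  let sel : EdgeVec n → Finset (⊤ : SimpleGraph (Fin n)).edgeSet := fun x =>
    if h : hasSmall x then h.choose else ∅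
  have hsel : ∀ x, hasSmall x → sel x ∈ 𝓒 ∧ #(sel x) < L ∧ dead x (sel x) := by
    intro x hx
    simp only [sel, dif_pos hx]
    exact ⟨hx.choose_spec.1, hx.choose_spec.2.1, hx.choose_spec.2.2⟩
  -- vertices of the selected clause
  let Vsel : EdgeVec n → Finset (Fin n) := fun x =>
    univ.filter fun v : Fin n => ∃ e ∈ sel x, v ∈ (e : Sym2 (Fin n))
  -- (1) per planted set: the three-way cover
  have hcover : ∀ A : Finset (Fin n),
      {x | plant A x ∈ {x : EdgeVec n | ∀ S ∈ 𝓒, ∃ e ∈ S, x e = true}} ⊆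
        ({x | ∀ S ∈ 𝓒, ∃ e ∈ S, x e = true} ∪
          ⋃ S ∈ 𝓒.filter (fun S => L ≤ #S), {x | ∀ e ∈ S, x e = false}) ∪
          {x | hasSmall x ∧ 2 ≤ #(A ∩ Vsel x)} := by
    intro A x hx
    simp only [Set.mem_setOf_eq] at hx
    by_cases h1 : ∀ S ∈ 𝓒, ∃ e ∈ S, x e = true
    · exact Or.inl (Or.inl h1)
    push Not at h1
    obtain ⟨S₀, hS₀, hdead₀⟩ := h1
    have hdead₀' : dead x S₀ := fun e he => by simpa using hdead₀ e he
    by_cases hL : L ≤ #S₀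
    · refine Or.inl (Or.inr (Set.mem_biUnion (x := S₀) (mem_filter.2 ⟨hS₀, hL⟩) ?_))
      exact hdead₀'
    · -- a small dead clause exists; the selected one is revived by a slot inside `A`
      have hsm : hasSmall x := ⟨S₀, hS₀, not_le.1 hL, hdead₀'⟩
      obtain ⟨hselC, -, hseldead⟩ := hsel x hsm
      obtain ⟨e, he, hpe⟩ := hx (sel x) hselC
      have hins : ∀ v ∈ (e : Sym2 (Fin n)), v ∈ A := by
        rcases (plant_apply_eq_true_iff A x e).1 hpe with hxe | hins
        · exact absurd hxe (by rw [hseldead e he]; decide)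
        · exact hins
      refine Or.inr ⟨hsm, ?_⟩
      -- the two endpoints of `e` lie in `A ∩ Vsel x`
      calc 2 = #(univ.filter fun v : Fin n => v ∈ (e : Sym2 (Fin n))) := (card_filter_mem_edge e).symm
        _ ≤ #(A ∩ Vsel x) := card_le_card fun v hv => by
            rw [mem_filter] at hv
            rw [mem_inter]
            exact ⟨hins v hv.2, mem_filter.2 ⟨mem_univ _, e, he, hv.2⟩⟩
  -- (2) the large dead clauses
  have hlarge : P0.toOuterMeasure (⋃ S ∈ 𝓒.filter (fun S => L ≤ #S), {x : EdgeVec n | ∀ e ∈ S, x e = false}) ≤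
      (#𝓒 : ℝ≥0∞) * 2⁻¹ ^ L := by
    calc P0.toOuterMeasure (⋃ S ∈ 𝓒.filter (fun S => L ≤ #S), {x : EdgeVec n | ∀ e ∈ S, x e = false})
        ≤ ∑ S ∈ 𝓒.filter (fun S => L ≤ #S), P0.toOuterMeasure {x : EdgeVec n | ∀ e ∈ S, x e = false} :=
          MeasureTheory.measure_biUnion_finset_le _ _
      _ ≤ ∑ S ∈ 𝓒.filter (fun S => L ≤ #S), (2⁻¹ : ℝ≥0∞) ^ L := sum_le_sum fun S hS => by
          refine (erdosRenyiHalf_forall_eq_false_le S).trans ?_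
          exact pow_le_pow_right_of_le_one' (ENNReal.inv_le_one.2 one_le_two) (mem_filter.1 hS).2
      _ = (#(𝓒.filter fun S => L ≤ #S) : ℝ≥0∞) * 2⁻¹ ^ L := by rw [sum_const, nsmul_eq_mul]
      _ ≤ (#𝓒 : ℝ≥0∞) * 2⁻¹ ^ L := by gcongr; exact filter_subset _ _
  -- (3) the selected small clause is touched: a count over `(A, x)` pairs, summed the other way
  have hsmallsum : ∑ A ∈ KS, P0.toOuterMeasure {x | hasSmall x ∧ 2 ≤ #(A ∩ Vsel x)} ≤
      ((#KS : ℕ) : ℝ≥0∞) * ((((2 * L).choose 2 * (min k n) ^ 2 : ℕ) : ℝ≥0∞) / ((n ^ 2 : ℕ) : ℝ≥0∞)) := by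
    -- write each measure as a normalized count and swap the sums
    have hcE : (Fintype.card (EdgeVec n) : ℝ≥0∞) ≠ 0 := by exact_mod_cast Fintype.card_ne_zero
    have hcEtop : (Fintype.card (EdgeVec n) : ℝ≥0∞) ≠ ⊤ := ENNReal.natCast_ne_top _
    have hcount : ∀ A, P0.toOuterMeasure {x | hasSmall x ∧ 2 ≤ #(A ∩ Vsel x)} =
        (Fintype.card (EdgeVec n) : ℝ≥0∞)⁻¹ *
          ∑ x : EdgeVec n, (if hasSmall x ∧ 2 ≤ #(A ∩ Vsel x) then (1 : ℝ≥0∞) else 0) := by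
      intro A
      rw [hP0, erdosRenyiHalf_toOuterMeasure_eq_card_div, div_eq_mul_inv, mul_comm, ← sum_filter, sum_const,
        nsmul_eq_mul, mul_one]
      simp only [Set.mem_setOf_eq]
    simp_rw [hcount]
    rw [← mul_sum, sum_comm]
    -- for each `x`: the `A` with `2 ≤ |A ∩ Vsel x|`
    have hx : ∀ x : EdgeVec n, (∑ A ∈ KS, if hasSmall x ∧ 2 ≤ #(A ∩ Vsel x) then (1 : ℝ≥0∞) else 0) ≤
        ((#KS : ℕ) : ℝ≥0∞) * ((((2 * L).choose 2 * (min k n) ^ 2 : ℕ) : ℝ≥0∞) / ((n ^ 2 : ℕ) : ℝ≥0∞)) := by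
      intro x
      by_cases hsm : hasSmall x
      · have htail := avg_kSubsets_card_inter_ge_le hn k 2 (Vsel x)
        have hne := card_kSubsets_cast_ne_zero n k
        have htop : ((#KS : ℕ) : ℝ≥0∞) ≠ ⊤ := ENNReal.natCast_ne_top _
        have hV : #(Vsel x) ≤ 2 * L := by
          refine (card_vertices_le_two_mul_card (sel x)).trans ?_
          exact Nat.mul_le_mul_left 2 (hsel x hsm).2.1.le
        calc (∑ A ∈ KS, if hasSmall x ∧ 2 ≤ #(A ∩ Vsel x) then (1 : ℝ≥0∞) else 0)
            = ((#(KS.filter fun A => 2 ≤ #(A ∩ Vsel x)) : ℕ) : ℝ≥0∞) := by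
              rw [← sum_filter, sum_const, nsmul_eq_mul, mul_one]
              congr 2
              exact filter_congr fun A _ => by simp [hsm]
          _ = ((#KS : ℕ) : ℝ≥0∞) * (((#KS : ℕ) : ℝ≥0∞)⁻¹ *
                ((#(KS.filter fun A => 2 ≤ #(A ∩ Vsel x)) : ℕ) : ℝ≥0∞)) := by
              rw [← mul_assoc, ENNReal.mul_inv_cancel hne htop, one_mul]
          _ ≤ ((#KS : ℕ) : ℝ≥0∞) * ((((#(Vsel x)).choose 2 * (min k n) ^ 2 : ℕ) : ℝ≥0∞) / ((n ^ 2 : ℕ) : ℝ≥0∞)) := by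
              gcongr
          _ ≤ _ := by
              gcongr ((#KS : ℕ) : ℝ≥0∞) * ((?_ : ℝ≥0∞) / _)
              exact_mod_cast Nat.mul_le_mul_right _ (Nat.choose_le_choose 2 hV)
      · calc (∑ A ∈ KS, if hasSmall x ∧ 2 ≤ #(A ∩ Vsel x) then (1 : ℝ≥0∞) else 0) = 0 :=
            sum_eq_zero fun A _ => if_neg fun h => hsm h.1
          _ ≤ _ := bot_le
    calc (Fintype.card (EdgeVec n) : ℝ≥0∞)⁻¹ *
          (∑ x : EdgeVec n, ∑ A ∈ KS, if hasSmall x ∧ 2 ≤ #(A ∩ Vsel x) then (1 : ℝ≥0∞) else 0)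
        ≤ (Fintype.card (EdgeVec n) : ℝ≥0∞)⁻¹ * (∑ _x : EdgeVec n, ((#KS : ℕ) : ℝ≥0∞) *
            ((((2 * L).choose 2 * (min k n) ^ 2 : ℕ) : ℝ≥0∞) / ((n ^ 2 : ℕ) : ℝ≥0∞))) := by
          gcongr with x _
          exact hx x
      _ = _ := by
          rw [sum_const, card_univ, nsmul_eq_mul, ← mul_assoc, ENNReal.inv_mul_cancel hcE hcEtop, one_mul]
  -- (4) assemble over `A`
  have hne := card_kSubsets_cast_ne_zero n k
  have htop : ((#KS : ℕ) : ℝ≥0∞) ≠ ⊤ := ENNReal.natCast_ne_top _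
  rw [plantedCliqueDist_toOuterMeasure_eq_sum]
  calc ((#KS : ℕ) : ℝ≥0∞)⁻¹ * ∑ A ∈ KS, P0.toOuterMeasure
          {x | plant A x ∈ {x : EdgeVec n | ∀ S ∈ 𝓒, ∃ e ∈ S, x e = true}}
      ≤ ((#KS : ℕ) : ℝ≥0∞)⁻¹ * ∑ A ∈ KS, (μ + (#𝓒 : ℝ≥0∞) * 2⁻¹ ^ L +
          P0.toOuterMeasure {x | hasSmall x ∧ 2 ≤ #(A ∩ Vsel x)}) := by
        gcongr with A _
        calc P0.toOuterMeasure {x | plant A x ∈ {x : EdgeVec n | ∀ S ∈ 𝓒, ∃ e ∈ S, x e = true}}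
            ≤ P0.toOuterMeasure (({x | ∀ S ∈ 𝓒, ∃ e ∈ S, x e = true} ∪
                ⋃ S ∈ 𝓒.filter (fun S => L ≤ #S), {x | ∀ e ∈ S, x e = false}) ∪
                {x | hasSmall x ∧ 2 ≤ #(A ∩ Vsel x)}) := P0.toOuterMeasure.mono (hcover A)
          _ ≤ P0.toOuterMeasure ({x | ∀ S ∈ 𝓒, ∃ e ∈ S, x e = true} ∪
                ⋃ S ∈ 𝓒.filter (fun S => L ≤ #S), {x | ∀ e ∈ S, x e = false}) +
              P0.toOuterMeasure {x | hasSmall x ∧ 2 ≤ #(A ∩ Vsel x)} := MeasureTheory.measure_union_le _ _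
          _ ≤ (μ + P0.toOuterMeasure (⋃ S ∈ 𝓒.filter (fun S => L ≤ #S), {x | ∀ e ∈ S, x e = false})) +
              P0.toOuterMeasure {x | hasSmall x ∧ 2 ≤ #(A ∩ Vsel x)} := by
              gcongr; exact MeasureTheory.measure_union_le _ _
          _ ≤ _ := by gcongr
    _ = μ + (#𝓒 : ℝ≥0∞) * 2⁻¹ ^ L +
          ((#KS : ℕ) : ℝ≥0∞)⁻¹ * ∑ A ∈ KS, P0.toOuterMeasure {x | hasSmall x ∧ 2 ≤ #(A ∩ Vsel x)} := by
        rw [sum_add_distrib, sum_const, nsmul_eq_mul, mul_add, ← mul_assoc, ENNReal.inv_mul_cancel hne htop,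
          one_mul]
    _ ≤ μ + (#𝓒 : ℝ≥0∞) * 2⁻¹ ^ L +
          ((#KS : ℕ) : ℝ≥0∞)⁻¹ * (((#KS : ℕ) : ℝ≥0∞) *
            ((((2 * L).choose 2 * (min k n) ^ 2 : ℕ) : ℝ≥0∞) / ((n ^ 2 : ℕ) : ℝ≥0∞))) := by
        gcongr
    _ = _ := by rw [← mul_assoc, ENNReal.inv_mul_cancel hne htop, one_mul]

/-! ### Asymptotics: polynomially many clauses -/

/-- `n^{c+2} ≤ 2^{(c+3)(⌊log₂ n⌋+1)}`. [folklore] -/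
theorem pow_le_two_pow_mul_log_succ (n c : ℕ) : n ^ (c + 2) ≤ 2 ^ ((c + 3) * (Nat.log 2 n + 1)) := by
  have h : n < 2 ^ (Nat.log 2 n + 1) := Nat.lt_pow_succ_log_self one_lt_two n
  calc n ^ (c + 2) ≤ (2 ^ (Nat.log 2 n + 1)) ^ (c + 2) := Nat.pow_le_pow_left h.le _
    _ = 2 ^ ((Nat.log 2 n + 1) * (c + 2)) := by rw [← pow_mul]
    _ ≤ 2 ^ ((c + 3) * (Nat.log 2 n + 1)) := Nat.pow_le_pow_right two_pos (by nlinarith)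

/-- **Quiet polynomial-size monotone CNFs are blind to the planted clique.** For `0 < δ < 1/2` and `c : ℕ`: clause
families with `#(𝓒 n) ≤ n^c` eventually and null acceptance `→ 0` have planted acceptance `→ 0` at clique size
`⌈n^{1/2-δ}⌉` (`cnf_planted_le` with `L = (c+3)(⌊log₂ n⌋+1)`: the two extra terms are `≤ (n²)⁻¹` and `≤ 4 n⁻¹`).
[folklore] -/
theorem karlinRubin_cnf_planted_tendsto_zero {δ : ℝ} (hδ : 0 < δ) (hδ' : δ < 1 / 2) (c : ℕ)
    (𝓒 : (n : ℕ) → Finset (Finset (⊤ : SimpleGraph (Fin n)).edgeSet))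
    (hM : ∀ᶠ n : ℕ in atTop, #(𝓒 n) ≤ n ^ c)
    (hquiet : Tendsto (fun n : ℕ =>
      (erdosRenyiHalf n).toOuterMeasure {x | ∀ S ∈ 𝓒 n, ∃ e ∈ S, x e = true}) atTop (𝓝 0)) :
    Tendsto (fun n : ℕ => (plantedCliqueDist n ⌈(n : ℝ) ^ (1 / 2 - δ)⌉₊).toOuterMeasure
      {x | ∀ S ∈ 𝓒 n, ∃ e ∈ S, x e = true}) atTop (𝓝 0) := by
  -- the bound `null + (n²)⁻¹ + 4 n⁻¹ → 0`
  have hinv2 : Tendsto (fun n : ℕ => (((n ^ 2 : ℕ) : ℝ≥0∞))⁻¹) atTop (𝓝 0) := by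
    refine tendsto_of_tendsto_of_tendsto_of_le_of_le' tendsto_const_nhds ENNReal.tendsto_inv_nat_nhds_zero
      (Eventually.of_forall fun _ => bot_le) ?_
    filter_upwards [eventually_ge_atTop 1] with n hn
    apply ENNReal.inv_le_inv.2
    exact_mod_cast (Nat.le_self_pow two_ne_zero n)
  have hinv1 : Tendsto (fun n : ℕ => (4 : ℝ≥0∞) * ((n : ℕ) : ℝ≥0∞)⁻¹) atTop (𝓝 0) := by
    have h := ENNReal.Tendsto.const_mul ENNReal.tendsto_inv_nat_nhds_zero
      (Or.inr ENNReal.ofNat_ne_top : (0 : ℝ≥0∞) ≠ 0 ∨ (4 : ℝ≥0∞) ≠ ⊤)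
    simpa using h
  have hbound : Tendsto (fun n : ℕ =>
      (erdosRenyiHalf n).toOuterMeasure {x | ∀ S ∈ 𝓒 n, ∃ e ∈ S, x e = true} +
        (((n ^ 2 : ℕ) : ℝ≥0∞))⁻¹ + 4 * ((n : ℕ) : ℝ≥0∞)⁻¹) atTop (𝓝 0) := by
    simpa using (hquiet.add hinv2).add hinv1
  refine tendsto_of_tendsto_of_tendsto_of_le_of_le' tendsto_const_nhds hbound
    (Eventually.of_forall fun _ => bot_le) ?_
  have hL : ∀ᶠ n : ℕ in atTop, c + 3 ≤ Nat.log 2 n := by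
    filter_upwards [eventually_ge_atTop (2 ^ (c + 3))] with n hn
    exact Nat.le_log_of_pow_le one_lt_two hn
  filter_upwards [hM, eventually_H1 hδ hδ', hL, eventually_ge_atTop 1] with n hMn H1 hLn hn1
  set ℓ := Nat.log 2 n with hℓ
  set L := (c + 3) * (ℓ + 1) with hLdef
  set d := min ⌈(n : ℝ) ^ (1 / 2 - δ)⌉₊ n with hd
  refine (cnf_planted_le hn1 _ L (𝓒 n)).trans ?_
  gcongr ?_ + ?_ + ?_
  · exact le_rfl
  · -- `#𝓒 · 2^{-L} ≤ n^c · (n^{c+2})⁻¹ = (n²)⁻¹`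
    have h2L : (2⁻¹ : ℝ≥0∞) ^ L ≤ (((n ^ (c + 2) : ℕ) : ℝ≥0∞))⁻¹ :=
      half_pow_le_inv_natCast (pow_le_two_pow_mul_log_succ n c)
    have h0 : ((n ^ c : ℕ) : ℝ≥0∞) ≠ 0 := by exact_mod_cast (pow_pos hn1 c).ne'
    have htop : ((n ^ c : ℕ) : ℝ≥0∞) ≠ ⊤ := ENNReal.natCast_ne_top _
    calc (#(𝓒 n) : ℝ≥0∞) * 2⁻¹ ^ L ≤ ((n ^ c : ℕ) : ℝ≥0∞) * (((n ^ (c + 2) : ℕ) : ℝ≥0∞))⁻¹ :=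
          mul_le_mul' (by exact_mod_cast hMn) h2L
      _ = (((n ^ 2 : ℕ) : ℝ≥0∞))⁻¹ := by
          have hsplit : ((n ^ (c + 2) : ℕ) : ℝ≥0∞) = ((n ^ c : ℕ) : ℝ≥0∞) * ((n ^ 2 : ℕ) : ℝ≥0∞) := by
            rw [pow_add, Nat.cast_mul]
          rw [hsplit, ENNReal.mul_inv (Or.inl h0) (Or.inl htop), ← mul_assoc, ENNReal.mul_inv_cancel h0 htop,
            one_mul]
  · -- `C(2L,2) d² / n² ≤ 4 n⁻¹`, from `(2 ℓ⁴ d)² ≤ n` and `L ≤ 2 ℓ⁴`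
    have hLℓ : L ≤ 2 * ℓ ^ 4 := by
      have h1 : (c + 3) * (ℓ + 1) ≤ ℓ * (ℓ + 1) := Nat.mul_le_mul_right _ hLn
      have h2 : ℓ * (ℓ + 1) ≤ 2 * ℓ ^ 4 := by
        have : 1 ≤ ℓ := le_trans (by omega : 1 ≤ c + 3) hLn
        nlinarith [Nat.one_le_pow 2 ℓ this, Nat.one_le_pow 3 ℓ this]
      exact h1.trans h2
    have hA : (2 * L).choose 2 * d ^ 2 ≤ 4 * n :=
      calc (2 * L).choose 2 * d ^ 2 ≤ (2 * L) ^ 2 * d ^ 2 := Nat.mul_le_mul_right _ (Nat.choose_le_pow _ _)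
        _ = (2 * L * d) ^ 2 := by ring
        _ ≤ (2 * (2 * ℓ ^ 4) * d) ^ 2 := by gcongr
        _ = 4 * (2 * ℓ ^ 4 * d) ^ 2 := by ring
        _ ≤ 4 * n := Nat.mul_le_mul_left 4 H1
    have hn0 : ((n : ℕ) : ℝ≥0∞) ≠ 0 := by exact_mod_cast (show n ≠ 0 by omega)
    have hntop : ((n : ℕ) : ℝ≥0∞) ≠ ⊤ := ENNReal.natCast_ne_top _
    have hn2 : ((n ^ 2 : ℕ) : ℝ≥0∞) ≠ 0 := by exact_mod_cast (pow_pos hn1 2).ne'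
    rw [ENNReal.div_le_iff hn2 (ENNReal.natCast_ne_top _)]
    calc (((2 * L).choose 2 * d ^ 2 : ℕ) : ℝ≥0∞) ≤ ((4 * n : ℕ) : ℝ≥0∞) := by exact_mod_cast hA
      _ = 4 * ((n : ℕ) : ℝ≥0∞)⁻¹ * ((n ^ 2 : ℕ) : ℝ≥0∞) := by
          push_cast
          rw [sq, ← mul_assoc, mul_assoc 4, ENNReal.inv_mul_cancel hn0 hntop, mul_one]

/-- **`MonotoneBlind` for monotone CNFs (depth 2, AND side).** For `0 < δ < 1/2` and every `c`, NO family of monotone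
CNFs with `≤ n^c` clauses has `Pr_{G(n,1/2)}[accept] + Pr_{G(n,1/2,⌈n^{1/2-δ}⌉)}[reject] → 0`. [folklore] -/
theorem karlinRubin_monotoneBlind_cnf {δ : ℝ} (hδ : 0 < δ) (hδ' : δ < 1 / 2) (c : ℕ) :
    ¬ ∃ 𝓒 : (n : ℕ) → Finset (Finset (⊤ : SimpleGraph (Fin n)).edgeSet),
      (∀ᶠ n : ℕ in atTop, #(𝓒 n) ≤ n ^ c) ∧
      Tendsto (fun n : ℕ =>
        (erdosRenyiHalf n).toOuterMeasure {x | ∀ S ∈ 𝓒 n, ∃ e ∈ S, x e = true} +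
          (plantedCliqueDist n ⌈(n : ℝ) ^ (1 / 2 - δ)⌉₊).toOuterMeasure
            {x | ¬ ∀ S ∈ 𝓒 n, ∃ e ∈ S, x e = true}) atTop (𝓝 0) := by
  rintro ⟨𝓒, hM, hT⟩
  have hquiet : Tendsto (fun n : ℕ =>
      (erdosRenyiHalf n).toOuterMeasure {x | ∀ S ∈ 𝓒 n, ∃ e ∈ S, x e = true}) atTop (𝓝 0) :=
    tendsto_of_tendsto_of_tendsto_of_le_of_le' tendsto_const_nhds hT (Eventually.of_forall fun _ => bot_le)
      (Eventually.of_forall fun _ => le_self_add)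
  have hP := karlinRubin_cnf_planted_tendsto_zero hδ hδ' c 𝓒 hM hquiet
  have hhalf : (0 : ℝ≥0∞) < 1 / 2 := by simp
  obtain ⟨n, hn1, hn2⟩ := ((hT.eventually (gt_mem_nhds hhalf)).and (hP.eventually (gt_mem_nhds hhalf))).exists
  have hcompl : (plantedCliqueDist n ⌈(n : ℝ) ^ (1 / 2 - δ)⌉₊).toOuterMeasure {x | ∀ S ∈ 𝓒 n, ∃ e ∈ S, x e = true} +
      (plantedCliqueDist n ⌈(n : ℝ) ^ (1 / 2 - δ)⌉₊).toOuterMeasure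
        {x | ¬ ∀ S ∈ 𝓒 n, ∃ e ∈ S, x e = true} = 1 := by
    have h := (plantedCliqueDist n ⌈(n : ℝ) ^ (1 / 2 - δ)⌉₊).toOuterMeasure_add_compl
      {x | ∀ S ∈ 𝓒 n, ∃ e ∈ S, x e = true}
    have hc : {x : EdgeVec n | ¬ ∀ S ∈ 𝓒 n, ∃ e ∈ S, x e = true} =
        {x : EdgeVec n | ∀ S ∈ 𝓒 n, ∃ e ∈ S, x e = true}ᶜ := by
      ext x; simp only [Set.mem_setOf_eq, Set.mem_compl_iff]
    rw [hc]
    exact h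
  have hR : (plantedCliqueDist n ⌈(n : ℝ) ^ (1 / 2 - δ)⌉₊).toOuterMeasure
      {x | ¬ ∀ S ∈ 𝓒 n, ∃ e ∈ S, x e = true} < 1 / 2 := lt_of_le_of_lt le_add_self hn1
  have hlt : (1 : ℝ≥0∞) < 1 / 2 + 1 / 2 := by
    calc (1 : ℝ≥0∞) = _ := hcompl.symm
      _ < 1 / 2 + 1 / 2 := ENNReal.add_lt_add hn2 hR
  rw [ENNReal.add_halves] at hlt
  exact lt_irrefl _ hlt

end Summit.PneNP.PneNP.Theorems
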